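import Summits.PneNP.PneNP.Theorems.RamseyNotNP.Negative.ThresholdLoadBearing
import Summits.PneNP.PneNP.Theorems.RamseyUncertifiableRamseyInCoNP

/-!
# `RamseyNotNP` (stmt-PneNP-9814) — negative-side lemmas: the sandwich, infinitude at the crux threshold, the one-sided consequence

Companion of `ThresholdLoadBearing.lean` (cdisprove, gen 1) for the crux
`Summit.PneNP.PneNP.Theses.RamseyUncertifiable.RamseyNotNP` (`RAMSEY₂ ∉ NP`):

* §1 THE SANDWICH. `not_ramseyNotNP_iff` — a disproof IS the membership `RAMSEY₂ ∈ NP`;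
  `not_ramseyNotNP_of_coNP_eq_NP` — the collapse `coNP = NP` refutes the crux (with the LANDED support
  `Summit.PneNP.PneNP.Theorems.ramseyInCoNP_proof`); `coNP_ne_NP_of_ramseyNotNP`, `NP_ne_P_of_ramseyNotNP` —
  the crux separates.  Neither side is reachable by search.  ROUTE NOTE `ramseyLang_thr_mem_P_of_not_pneNP`
  (contrapositive form): the weaker `RAMSEY₂ ∉ P` closes the summit through the same assembly
  (`ramseyNotP_of_ramseyNotNP`).
* §5' `ramseyLang_thr_infinite` (Erdős 1947 along `n = 2^m`: `C(2^m,2m)·2^{1-C(2m,2)} ≤ 2^{m+1}/(2m)! < 1`,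
  tree fact `erdos1947_ramsey_lower_holds`) and `ramseyLang_thr_coinfinite` (complete graphs): the necessary
  conditions of `ThresholdLoadBearing` §5 hold, so no finiteness / triviality refutation exists.
* §6 `not_ramseyNotCoNP` — the strengthening "RAMSEY₂ ∉ coNP" is false.
* §8 `inter_mem_NP` (`NP` is closed under intersection) and `oneSided_of_ramseyNotNPAt` — the crux forces
  `CLIQUEFREE_k ∉ NP ∨ INDEPFREE_k ∉ NP` (`ramseyLangAt_eq_inter`); sharpened to `CLIQUEFREE_k ∉ NP` in
  `ComplementSymmetry.lean`.

Refuter seat cdisprove-stmt-PneNP-9814, 2026-08-16.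
-/

-- `Summit.PneNP.PneNP.…` duplicates `PneNP` BY DESIGN (single-problem summit, D-0017).
set_option linter.dupNamespace false

namespace Summit.PneNP.PneNP.Theorems.RamseyNotNP.Negative

open Literature.Computability.Complexity _root_.Computability
open Summit.PneNP.PneNP.Theses.RamseyUncertifiable (RamseyNotNP RamseyInCoNP)

/-! ## §1 A disproof is an NP-membership proof; the sandwich `coNP = NP ⟹ ¬crux`, `crux ⟹ coNP ≠ NP` -/

/-- `¬ RamseyNotNP` is literally `RAMSEY₂ ∈ NP`. [folklore] -/
theorem not_ramseyNotNP_iff : ¬ RamseyNotNP ↔ ramseyLangAt thr ∈ Nondeterministic.NP := not_not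

/-- RAMSEY₂ ∈ coNP — the route's support item `RamseyInCoNP`, LANDED in the tree
(`Summit.PneNP.PneNP.Theorems.ramseyInCoNP_proof`). [folklore] -/
theorem ramseyLang_thr_mem_coNP : ramseyLangAt thr ∈ coNP :=
  Summit.PneNP.PneNP.Theorems.ramseyInCoNP_proof

/-- **A collapse refutes the crux**: `coNP = NP → ¬ RamseyNotNP`. [folklore] -/
theorem not_ramseyNotNP_of_coNP_eq_NP (h : coNP = Nondeterministic.NP) : ¬ RamseyNotNP :=
  fun hX => hX (h ▸ ramseyLang_thr_mem_coNP)

/-- **The crux separates `coNP` from `NP`.** [folklore] -/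
theorem coNP_ne_NP_of_ramseyNotNP (hX : RamseyNotNP) : coNP ≠ Nondeterministic.NP :=
  fun h => not_ramseyNotNP_of_coNP_eq_NP h hX

/-- **The crux separates `NP` from `P`** (`P = co P`, tree fact `co_P_holds`). [folklore] -/
theorem NP_ne_P_of_ramseyNotNP (hX : RamseyNotNP) : Nondeterministic.NP ≠ Classes.P := by
  intro h
  apply coNP_ne_NP_of_ramseyNotNP hX
  show co Nondeterministic.NP = Nondeterministic.NP
  rw [h]
  exact co_P_holds

/-- If the summit fails then `coNP = P` (the bridges `P_bool_eq_holds`, `np_bool_eq`, `co_P_holds`).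
[folklore] -/
theorem coNP_eq_P_of_not_pneNP (hne : ¬ PneNP) : coNP = Classes.P := by
  have hP : Literature.Computability.Complexity.PNPWave0.P Bool = Classes.P := P_bool_eq_holds
  have hN : Literature.Computability.Complexity.PNPWave0.NP Bool = Nondeterministic.NP := np_bool_eq
  have hsub : Nondeterministic.NP ⊆ Classes.P := by
    intro L hL
    by_contra hL'
    exact hne ⟨L, hN ▸ hL, hP ▸ hL'⟩
  have heq : Nondeterministic.NP = Classes.P := Set.Subset.antisymm hsub P_subset_NP_holds
  show co Nondeterministic.NP = Classes.P
  rw [heq]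
  exact co_P_holds

/-- **ROUTE NOTE — the weaker target suffices** (stated contrapositively: no summit conclusion in this
file).  If the summit fails then `RAMSEY₂ ∈ P`; i.e. already `RAMSEY₂ ∉ P` closes the summit through the
same assembly (`¬PneNP ⟹ NP = P ⟹ coNP = P ∋ RAMSEY₂`): the crux `RAMSEY₂ ∉ NP` is STRONGER than the summit
needs by exactly the commitment `coNP ≠ NP`. [folklore] -/
theorem ramseyLang_thr_mem_P_of_not_pneNP (hne : ¬ PneNP) : ramseyLangAt thr ∈ Classes.P :=
  coNP_eq_P_of_not_pneNP hne ▸ ramseyLang_thr_mem_coNP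

/-- The crux implies the weaker target (`P ⊆ NP`). [folklore] -/
theorem ramseyNotP_of_ramseyNotNP (hX : RamseyNotNP) : ramseyLangAt thr ∉ Classes.P :=
  fun h => hX (P_subset_NP_holds h)

/-! ## §5' Both necessary conditions hold at the crux threshold -/

/-- **Co-infinitude at the crux threshold**: the codes of `K_n`, `n ≥ 4`, lie outside. [folklore] -/
theorem ramseyLang_thr_coinfinite :
    (Set.range encodingGraph.encode \ ramseyLangAt thr : Set (List Bool)).Infinite := by
  have hinj : Function.Injective fun m : ℕ => encodingGraph.encode ⟨m + 4, (⊤ : SimpleGraph (Fin (m + 4)))⟩ := by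
    intro a b hab
    have := congrArg Sigma.fst (encodingGraph.encode_injective hab)
    simpa using this
  refine Set.infinite_of_injective_forall_mem hinj fun m => ⟨⟨_, rfl⟩, fun hm => ?_⟩
  have hm' := (Encoding.mem_toLanguage_iff _ _ _).1 hm
  exact top_not_mem (by omega) hm'

/-- The Erdős union bound at dyadic sizes: `C(2^m, 2m) · 2^{1 - C(2m, 2)} < 1` for `m ≥ 2`
(`≤ 2^{m+1}/(2m)!`). [folklore] -/
theorem erdos_bound_two_pow {m : ℕ} (hm : 2 ≤ m) :
    ((2 ^ m).choose (2 * m) : ℝ) * (2 : ℝ) ^ ((1 : ℝ) - ((2 * m).choose 2 : ℝ)) < 1 := by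
  -- the factorial beats the power: 2^{m+1} < (2m)!
  have hfact : ∀ m, 2 ≤ m → 2 ^ (m + 1) < (2 * m).factorial := by
    intro m hm
    induction m, hm using Nat.le_induction with
    | base => decide
    | succ m hm ih =>
      have e : (2 * (m + 1)).factorial = (2 * m + 2) * ((2 * m + 1) * (2 * m).factorial) := by
        rw [show 2 * (m + 1) = (2 * m + 1) + 1 by ring, Nat.factorial_succ, Nat.factorial_succ]
      rw [e, pow_succ]
      calc 2 ^ (m + 1) * 2 < (2 * m).factorial * 2 := by linarith
        _ = 2 * (2 * m).factorial := mul_comm _ _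
        _ ≤ (2 * m + 2) * ((2 * m + 1) * (2 * m).factorial) :=
          Nat.mul_le_mul (by omega) (Nat.le_mul_of_pos_left _ (by omega))
  -- exponent bookkeeping: (2^m)^(2m) · 2 = 2^(m+1) · 2^(C(2m,2))
  have hexp : m * (2 * m) + 1 = (m + 1) + (2 * m).choose 2 := by
    rw [Nat.choose_two_right]
    obtain ⟨m', rfl⟩ : ∃ m', m = m' + 1 := ⟨m - 1, by omega⟩
    have : 2 * (m' + 1) * (2 * (m' + 1) - 1) / 2 = (m' + 1) * (2 * m' + 1) := by
      rw [show 2 * (m' + 1) * (2 * (m' + 1) - 1) = 2 * ((m' + 1) * (2 * m' + 1)) by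
        rw [show 2 * (m' + 1) - 1 = 2 * m' + 1 by omega]; ring]
      simp
    rw [this]; ring
  have hchoose : ((2 ^ m).choose (2 * m) : ℝ) ≤ ((2 : ℝ) ^ m) ^ (2 * m) / (2 * m).factorial := by
    have := Nat.choose_le_pow_div (2 * m) (2 ^ m) (α := ℝ)
    push_cast at this
    exact this
  have hrpow : (2 : ℝ) ^ ((1 : ℝ) - ((2 * m).choose 2 : ℝ)) = 2 / (2 : ℝ) ^ ((2 * m).choose 2) := by
    rw [Real.rpow_sub two_pos, Real.rpow_one, Real.rpow_natCast]
  rw [hrpow]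
  have hpos : (0 : ℝ) < (2 * m).factorial := by exact_mod_cast Nat.factorial_pos _
  have hpow : (0 : ℝ) < (2 : ℝ) ^ ((2 * m).choose 2) := by positivity
  calc ((2 ^ m).choose (2 * m) : ℝ) * (2 / (2 : ℝ) ^ ((2 * m).choose 2))
      ≤ ((2 : ℝ) ^ m) ^ (2 * m) / (2 * m).factorial * (2 / (2 : ℝ) ^ ((2 * m).choose 2)) :=
        mul_le_mul_of_nonneg_right hchoose (by positivity)
    _ = (2 : ℝ) ^ (m + 1) / (2 * m).factorial := by
        rw [div_mul_div_comm, ← pow_mul, ← pow_succ, hexp, pow_add,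
          mul_div_mul_right _ _ (ne_of_gt hpow)]
    _ < 1 := by
        rw [div_lt_one hpos]
        exact_mod_cast hfact m hm

/-- **Erdős 1947 at dyadic sizes**: for `m ≥ 2` some graph on `2^m` vertices is a member of the crux set
(threshold `thr (2^m) = 2m`). [folklore] -/
theorem exists_mem_two_pow {m : ℕ} (hm : 2 ≤ m) :
    ∃ G : SimpleGraph (Fin (2 ^ m)), (⟨2 ^ m, G⟩ : Σ n, SimpleGraph (Fin n)) ∈ ramseySetAt thr := by
  obtain ⟨G, hG⟩ := Literature.Combinatorics.SimpleGraph.erdos1947_ramsey_lower_holds (2 ^ m) (2 * m)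
    (erdos_bound_two_pow hm)
  refine ⟨G, ?_⟩
  show G.CliqueFree (thr (2 ^ m)) ∧ Gᶜ.CliqueFree (thr (2 ^ m))
  rw [thr_two_pow]
  exact hG

/-- **The crux set is infinite** (so `RamseyNotNP` is not refutable by finiteness). [folklore] -/
theorem ramseySetAt_thr_infinite : (ramseySetAt thr).Infinite := by
  choose G hG using fun m : ℕ => exists_mem_two_pow (m := m + 2) (by omega)
  have hinj : Function.Injective fun m : ℕ => (⟨2 ^ (m + 2), G m⟩ : Σ n, SimpleGraph (Fin n)) := by
    intro a b hab
    have h1 : 2 ^ (a + 2) = 2 ^ (b + 2) := congrArg Sigma.fst hab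
    have := Nat.pow_right_injective le_rfl h1
    omega
  exact Set.infinite_of_injective_forall_mem hinj hG

/-- **The crux language is infinite.** [folklore] -/
theorem ramseyLang_thr_infinite : (ramseyLangAt thr : Set (List Bool)).Infinite :=
  ramseySetAt_thr_infinite.image encodingGraph.encode_injective.injOn

/-! ## §6 Strengthenings refuted -/

/-- The strengthening "RAMSEY₂ ∉ coNP" is FALSE (landed support). [folklore] -/
theorem not_ramseyNotCoNP : ¬ (ramseyLangAt thr ∉ coNP) := fun h => h ramseyLang_thr_mem_coNP

/-! ## §8 `NP` is closed under intersection; the one-sided consequence of the crux -/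

/-- **`NP` is closed under binary intersection** (concatenate the two witnesses as a pair; the verifier
projects and re-checks both length bounds, `LenLe`). [folklore] -/
theorem inter_mem_NP {L₁ L₂ : Language Bool} (h₁ : L₁ ∈ Nondeterministic.NP)
    (h₂ : L₂ ∈ Nondeterministic.NP) : L₁ ⊓ L₂ ∈ Nondeterministic.NP := by
  obtain ⟨V₁, hV₁, q₁, hq₁⟩ := h₁
  obtain ⟨V₂, hV₂, q₂, hq₂⟩ := h₂
  -- projections of `w = ⟨x, ⟨y₁, y₂⟩⟩` to `⟨x, y₁⟩` and `⟨x, y₂⟩`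
  set π₁ : List Bool → List Bool := fanoutFn Brick.fstF (Brick.fstF ∘ Brick.sndF) with hπ₁def
  set π₂ : List Bool → List Bool := fanoutFn Brick.fstF (Brick.sndF ∘ Brick.sndF) with hπ₂def
  have hπ₁ : π₁ ∈ FP :=
    fanoutFn_mem_FP Brick.fstF_mem_FP (comp_mem_FP Brick.fstF_mem_FP Brick.sndF_mem_FP)
  have hπ₂ : π₂ ∈ FP :=
    fanoutFn_mem_FP Brick.fstF_mem_FP (comp_mem_FP Brick.sndF_mem_FP Brick.sndF_mem_FP)
  have e₁ : ∀ x y, π₁ (boolPair x y) = boolPair x (Brick.fstF y) := fun x y => by simp [hπ₁def]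
  have e₂ : ∀ x y, π₂ (boolPair x y) = boolPair x (Brick.sndF y) := fun x y => by simp [hπ₂def]
  refine ⟨(π₁ ⁻¹' (LenLe q₁ ⊓ V₁) : Language Bool) ⊓ (π₂ ⁻¹' (LenLe q₂ ⊓ V₂) : Language Bool),
    inter_mem_P (preimage_mem_P (inter_mem_P (LenLe_mem_P q₁) hV₁) hπ₁)
      (preimage_mem_P (inter_mem_P (LenLe_mem_P q₂) hV₂) hπ₂), 2 * q₁ + 2 + q₂, fun x => ?_⟩
  have heval : ∀ n, (2 * q₁ + 2 + q₂ : Polynomial ℕ).eval n = 2 * q₁.eval n + 2 + q₂.eval n := by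
    intro n; simp [Polynomial.eval_add, Polynomial.eval_mul]
  change x ∈ L₁ ∧ x ∈ L₂ ↔ ∃ y, y.length ≤ (2 * q₁ + 2 + q₂ : Polynomial ℕ).eval x.length ∧
    (π₁ (boolPair x y) ∈ LenLe q₁ ∧ π₁ (boolPair x y) ∈ V₁) ∧
      (π₂ (boolPair x y) ∈ LenLe q₂ ∧ π₂ (boolPair x y) ∈ V₂)
  simp only [heval, e₁, e₂, boolPair_mem_LenLe]
  constructor
  · rintro ⟨hx₁, hx₂⟩
    obtain ⟨y₁, hy₁, hw₁⟩ := (hq₁ x).1 hx₁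
    obtain ⟨y₂, hy₂, hw₂⟩ := (hq₂ x).1 hx₂
    refine ⟨boolPair y₁ y₂, ?_, ?_, ?_⟩
    · rw [length_boolPair]; omega
    · simpa using And.intro hy₁ hw₁
    · simpa using And.intro hy₂ hw₂
  · rintro ⟨y, -, ⟨hl₁, hw₁⟩, ⟨hl₂, hw₂⟩⟩
    exact ⟨(hq₁ x).2 ⟨_, hl₁, hw₁⟩, (hq₂ x).2 ⟨_, hl₂, hw₂⟩⟩

/-- The one-sided languages: no `k n`-clique, resp. no `k n`-independent set. [folklore] -/
def cliqueFreeLangAt (k : ℕ → ℕ) : Language Bool :=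
  encodingGraph.toLanguage {p : Σ n, SimpleGraph (Fin n) | p.2.CliqueFree (k p.1)}

/-- (second one-sided language) [folklore] -/
def indepFreeLangAt (k : ℕ → ℕ) : Language Bool :=
  encodingGraph.toLanguage {p : Σ n, SimpleGraph (Fin n) | p.2ᶜ.CliqueFree (k p.1)}

/-- `RAMSEY_k = CLIQUEFREE_k ∩ INDEPFREE_k` (images of an injective code). [folklore] -/
theorem ramseyLangAt_eq_inter (k : ℕ → ℕ) :
    ramseyLangAt k = cliqueFreeLangAt k ⊓ indepFreeLangAt k := by
  change encodingGraph.encode '' _ = encodingGraph.encode '' _ ∩ encodingGraph.encode '' _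
  rw [← Set.image_inter encodingGraph.encode_injective]
  rfl

/-- **One-sided consequence of the crux.** `RAMSEY_k ∉ NP` forces `CLIQUEFREE_k ∉ NP` or
`INDEPFREE_k ∉ NP`: proving the crux entails that "no `⌈2log₂ n⌉`-clique" (or its complement twin) has
no polynomial certificates either — the crux is at least as strong as the one-sided `coCLIQUE_{2log₂ n} ∉ NP`
disjunction, while the route's SoS mechanism (`las(G)·las(Ḡ) ≥ n^δ`) speaks only to the two-sided
language. [folklore] -/
theorem oneSided_of_ramseyNotNPAt {k : ℕ → ℕ} (h : RamseyNotNPAt k) :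
    cliqueFreeLangAt k ∉ Nondeterministic.NP ∨ indepFreeLangAt k ∉ Nondeterministic.NP := by
  by_contra hc
  push Not at hc
  apply h
  show ramseyLangAt k ∈ Nondeterministic.NP
  rw [ramseyLangAt_eq_inter]
  exact inter_mem_NP hc.1 hc.2


end Summit.PneNP.PneNP.Theorems.RamseyNotNP.Negative
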